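import Summits.Schanuel.Schanuel.Theorems.DiophantineDichotomyKhovanskiiApproxTypeEvRareFieldLWDh
import Summits.Schanuel.Schanuel.Theorems.DiophantineDichotomyKhovanskiiApproxTypeEvPairSumMeasure
import HarnessLib

/-!
# Mahler 1932 / Ably 1994 at one variable in clause currency, linear in the degree
# (`stub_expAlgIrredClauseMeasure`) — crux `DiophantineDichotomy.KhovanskiiApproxTypeEv` (stmt-Schanuel-14972)

Line `Sketch` of crux `DiophantineDichotomy.KhovanskiiApproxTypeEv` (stmt-Schanuel-14972), skeleton v10
(lead `prover-line-stmt-Schanuel-14972-c12-0`), registered stub `stub_expAlgIrredClauseMeasure` (sub-goal B of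
the PRINT SIDE of leaf B's hardness certificate) — `--supports`.

For algebraic `β ≠ 0` there is `C > 0` such that for every degree budget `D`, beyond a threshold `H₀(D)`,
every `z ∈ ℂ` carrying an integer clause `R` that is irreducible over `ℚ`, of degree `≤ D` and naive height
`≤ H`, satisfies `|z − e^β| ≥ exp(−C · deg R · log H)`.  Route: the LANDED Lindemann–Weierstrass layer in
`(d,h)` currency `evLWDh` (p137028) at rank `n = 1` and the point `(β)` (exponent `1 + 1/1 = 2`), applied to
the challenger `γ = (β, z)` at level `(d, H)` with `d := N_β · deg R` (`N_β = [ℚ(β):ℚ] + deg T_β`, `T_β` a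
fixed integer clause of `β`) and `m := deg R = deg minpoly_ℚ z`, so that `C d² log H / m = C N_β² · deg R · log H`;
threshold `H₀(D) := max (max_{d ≤ N_β D} H₀^{evLWDh}(d)) B_β`.  Everything here is proved; no named facts.
-/

noncomputable section

set_option linter.dupNamespace false -- mandated summit/sub-problem namespace (single-conjunct summit)

namespace Summit.Schanuel.Schanuel.Cruxes.KhovanskiiApproxTypeEv.AnchoredReduction

open Summit.Schanuel.Schanuel.Cruxes.KhovanskiiApproxType.LwSmallHeight
  (natDegree_pos_of_aeval_eq_zero)
open Summit.Schanuel.Schanuel.Cruxes.KhovanskiiApproxTypeEv.RareFieldSpecies (evLWDh)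
open Polynomial

/-! ## Bookkeeping -/

/-- An integer clause `R` of `z` that is irreducible over `ℚ` is non-zero, has positive degree, makes `z`
integral over `ℚ`, and has the degree of `z`: `deg minpoly_ℚ z = deg R`. [folklore] -/
theorem clause_of_irreducible_map {z : ℂ} {R : Polynomial ℤ}
    (hirr : Irreducible (R.map (Int.castRingHom ℚ))) (hz : Polynomial.aeval z R = 0) :
    R ≠ 0 ∧ 1 ≤ R.natDegree ∧ IsIntegral ℚ z ∧ (minpoly ℚ z).natDegree = R.natDegree := by
  have hR0 : R ≠ 0 := fun h => hirr.ne_zero (by rw [h, Polynomial.map_zero])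
  obtain ⟨hdeg, hint⟩ := natDegree_pos_of_aeval_eq_zero hR0 hz
  refine ⟨hR0, hdeg, hint, ?_⟩
  have hz' : Polynomial.aeval z (R.map (Int.castRingHom ℚ)) = 0 := by
    rw [← algebraMap_int_eq, aeval_map_algebraMap]; exact hz
  rw [← minpoly.eq_of_irreducible hirr hz',
    natDegree_mul_C (inv_ne_zero (leadingCoeff_ne_zero.2 hirr.ne_zero)),
    natDegree_map_eq_of_injective (Int.castRingHom ℚ).injective_int]

/-- Sup-norm bookkeeping at rank 1: the challenger `(β, z)` is as far from `θ = (β, e^β)` as `z` is from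
`e^β`. [folklore] -/
theorem norm_pair_sub_le (β z : ℂ) :
    ‖(Sum.elim (fun _ : Fin 1 => β) (fun _ : Fin 1 => z) : Fin 1 ⊕ Fin 1 → ℂ) -
        Sum.elim (fun _ : Fin 1 => β) (Complex.exp ∘ fun _ : Fin 1 => β)‖ ≤ ‖z - Complex.exp β‖ := by
  refine (pi_norm_le_iff_of_nonneg (norm_nonneg _)).2 ?_
  rintro (i | j)
  · simp
  · simp

/-! ## The measure -/

/-- **`stub_expAlgIrredClauseMeasure` — Mahler 1932 / Ably 1994 at `m = 1` in clause currency, LINEAR in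
the degree** (registered sub-goal B of skeleton v10, line `Sketch`; lead c12).  For algebraic `β ≠ 0` there is
`C > 0` such that for every degree budget `D`, beyond a threshold `H₀(D)`, every `z ∈ ℂ` carrying an
irreducible-over-`ℚ` integer clause `R` of degree `≤ D` and naive height `≤ H` satisfies
`|z − e^β| ≥ exp(−C · deg R · log H)`.  Proof: the landed LW layer in `(d,h)` currency `evLWDh` (Ably 1994 +
penalty transfer, p137028) at rank `1` and the point `(β)`, challenger `γ = (β, z)` at level `(N_β · deg R, H)`
with `m = deg R = deg minpoly_ℚ z`, so that `C d² log H / m = C N_β² · deg R · log H`.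
[cite: Ably1994, Théorème p. 30] -/
theorem stub_expAlgIrredClauseMeasure (β : ℂ) (hβ : IsAlgebraic ℚ β) (hβ0 : β ≠ 0) :
    ∃ C : ℝ, 0 < C ∧ ∀ D : ℕ, ∃ H₀ : ℕ, ∀ (H : ℕ) (z : ℂ) (R : Polynomial ℤ), H₀ ≤ H →
      Irreducible (R.map (Int.castRingHom ℚ)) → Polynomial.aeval z R = 0 → R.natDegree ≤ D →
      (∀ l, |R.coeff l| ≤ (H : ℤ)) →
      Real.exp (-(C * (R.natDegree : ℝ) * Real.log H)) ≤ ‖z - Complex.exp β‖ := by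
  -- the fixed clause of `β` and the degree of `ℚ(β)`
  obtain ⟨T, B, hT0, hTB, hTroot⟩ := exists_intPoly_bound_of_isAlgebraic hβ
  set Ks : IntermediateField ℚ ℂ := IntermediateField.adjoin ℚ {β}
  haveI : FiniteDimensional ℚ Ks := IntermediateField.adjoin.finiteDimensional hβ.isIntegral
  set M : ℕ := Module.finrank ℚ Ks
  have hM1 : 1 ≤ M := Module.finrank_pos
  set N : ℕ := M + T.natDegree
  have hMN : M ≤ N := Nat.le_add_right _ _
  have hTN : T.natDegree ≤ N := Nat.le_add_left _ _
  have hN1 : 1 ≤ N := hM1.trans hMN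
  -- the Lindemann–Weierstrass layer in `(d,h)` currency at rank `1` and the point `(β)`
  have hli : LinearIndependent ℚ (fun _ : Fin 1 => β) := linearIndependent_unique_iff.2 hβ0
  obtain ⟨C, hC, hall⟩ := evLWDh 1 (fun _ => β) le_rfl (fun _ => hβ) hli
  choose H₀f hH₀f using hall
  refine ⟨C * (N : ℝ) ^ 2, by positivity, fun D => ?_⟩
  refine ⟨max ((Finset.range (N * D + 1)).sup H₀f) B, fun H z R hH hirr hz hRD hRH => ?_⟩
  -- the irreducible clause of `z`
  obtain ⟨hR0, hm1, hzint, hmin⟩ := clause_of_irreducible_map hirr hz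
  set m : ℕ := R.natDegree
  set d : ℕ := N * m with hd
  have hmd : m ≤ d := Nat.le_mul_of_pos_left m hN1
  have hNd : N ≤ d := Nat.le_mul_of_pos_right N hm1
  have hdD : d < N * D + 1 := Nat.lt_succ_of_le (Nat.mul_le_mul_left N hRD)
  have hH0 : H₀f d ≤ H :=
    le_trans (Finset.le_sup (f := H₀f) (Finset.mem_range.2 hdD)) (le_trans (le_max_left _ _) hH)
  have hBH : B ≤ H := le_trans (le_max_right _ _) hH
  -- the challenger `γ = (β, z)` and its admissibility at level `(d, H)`
  set γ : Fin 1 ⊕ Fin 1 → ℂ := Sum.elim (fun _ => β) (fun _ => z)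
  have hclause : ∀ i, ∃ P : Polynomial ℤ, P ≠ 0 ∧ P.natDegree ≤ d ∧ (∀ k, |P.coeff k| ≤ (H : ℤ)) ∧
      Polynomial.aeval (γ i) P = 0 := by
    rintro (i | j)
    · exact ⟨T, hT0, hTN.trans hNd, fun k => (hTB k).trans (by exact_mod_cast hBH), hTroot⟩
    · exact ⟨R, hR0, hmd, hRH, hz⟩
  have hdegc : ∀ j : Fin 1, m ≤ (minpoly ℚ (γ (Sum.inr j))).natDegree := fun j => by
    show m ≤ (minpoly ℚ z).natDegree
    exact hmin.ge
  have hfr : Module.finrank ℚ ↥(IntermediateField.adjoin ℚ (Set.range γ)) ≤ d := by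
    set Kz : IntermediateField ℚ ℂ := IntermediateField.adjoin ℚ {z} with hKz
    haveI : FiniteDimensional ℚ Kz := IntermediateField.adjoin.finiteDimensional hzint
    have hKzm : Module.finrank ℚ Kz = m := by
      rw [hKz, IntermediateField.adjoin.finrank hzint, hmin]
    have hle : IntermediateField.adjoin ℚ (Set.range γ) ≤ Ks ⊔ Kz := by
      rw [IntermediateField.adjoin_le_iff]
      rintro _ ⟨i | j, rfl⟩
      · exact (le_sup_left : Ks ≤ Ks ⊔ Kz) (IntermediateField.subset_adjoin ℚ _ (Set.mem_singleton β))
      · exact (le_sup_right : Kz ≤ Ks ⊔ Kz) (IntermediateField.subset_adjoin ℚ _ (Set.mem_singleton z))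
    calc Module.finrank ℚ ↥(IntermediateField.adjoin ℚ (Set.range γ))
        ≤ Module.finrank ℚ ↥(Ks ⊔ Kz) := IntermediateField.finrank_le_of_le_right hle
      _ ≤ Module.finrank ℚ Ks * Module.finrank ℚ Kz := IntermediateField.finrank_sup_le Ks Kz
      _ ≤ d := by rw [hd, hKzm]; exact Nat.mul_le_mul_right m hMN
  -- the landed bound at level `(d, H)` with `m = deg R`, and the comparison of exponents
  have key := hH₀f d H m γ hH0 hm1 hmd hfr hclause hdegc
  have hm0 : (m : ℝ) ≠ 0 := by exact_mod_cast (show m ≠ 0 by omega)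
  have hp : (1 + 1 / ((1 : ℕ) : ℝ) : ℝ) = ((2 : ℕ) : ℝ) := by norm_num
  have hexp : C * (d : ℝ) ^ (1 + 1 / ((1 : ℕ) : ℝ)) * Real.log H / m =
      C * (N : ℝ) ^ 2 * (m : ℝ) * Real.log H := by
    rw [hp, Real.rpow_natCast, hd]
    push_cast
    field_simp
  rw [hexp] at key
  exact key.trans (norm_pair_sub_le β z)

end Summit.Schanuel.Schanuel.Cruxes.KhovanskiiApproxTypeEv.AnchoredReduction

end
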